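/-
Copyright (c) 2026 the pub-hodgecm-mathlib formalisation cell (harness21).  Prover seat hodgecm-mathlib-B-p04 (g47): LH4-plan (g6) WORD #17 «WILD QUADRATIC FRAME» FILE 1
(the first plank of the M4∕M6∕(D-RAM) wall of census F0P3a-p06 (g17) `DUNR-H2-CENSUS` §3–§4); 2026-09-02.
-/
import Literature.NumberTheory.LocalFields.ValuedPrincipalUnitsProP     -- ★ `valued_eq_one_of_valued_sub_one_lt_one'`, `lt_one_iff_le_exp_neg_one` (light `Valued` toolkit)
import HarnessLib

/-!
# The WILD quadratic frame: the Eisenstein uniformiser `Π = (α − 1)∕ϖ^k` of `K₂ = K(α)`, `α² = 1 + w`, `ord_K w = 2k + 1 < 2e`, with `ιΠ = −Π − 2∕ϖ^k` and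
# `v(ιΠ − Π) = |2|·|ϖ|^{−k}` (Serre, *Local Fields* I §6 Prop. 18, III §6, IV §1–§2; O'Meara §63A 63:2–63:5; Jacobowitz 1962 §§9–11 «R-U»)

Topic `NumberTheory/LocalFields`; namespace `Literature.NumberTheory.LocalFields`.  THEOREMS ONLY (no definition, no instance, no notation, no named fact, no `sorry`); define-free,
CM-free; kernel lane `--supports stmt-HodgeConjecture-24833`.  Cell `pub/hodgecm-mathlib` (D-0151), crux H413 = `stmt-HodgeConjecture-24833`, half A line LH4 (dyadic pay-down);
LH4-plan (g6) WORD #14∕#17: «M4 + M6 need a WILD EIGEN-FRAME — no `ι`-anti-fixed uniformiser exists in wild `K₂∕L_w`» (the tame frame of ★ `TypeTwoEigenFieldPackage` ∕ ★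
`SymmetricEigenframe*` ∕ ★ `RamifiedQuadraticOrderLattices` is keyed on `θ` with `ιθ = −θ`, `|θ| = exp(−1)`, which at a WILD quadratic `K₂ = K(√(1 + w))` with `1 + w` a unit
of odd defect does not exist: every anti-fixed element is `α·(base)` and has EVEN valuation).  THIS FILE supplies the replacement: the EISENSTEIN uniformiser and its
`ι`-conjugate.  HONEST LABEL: HC_CM is proved only modulo the 7 printed citations (2 remaining named inputs: hLiu418 = stmt-HodgeConjecture-24832, h413 =
stmt-HodgeConjecture-24833) until rung 0 closes; count-neutral (pays no organ, opens no road — first plank of the M4∕M6∕(D-RAM) wall, nothing more).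

CURRENCY (one-field, §1–§3): `K` (the quadratic extension `K₂`) with `Valued K ℤᵐ⁰`, an isometric involution `ι : K →+* K`; «base» quantities are `ι`-FIXED elements of `K`
in the RAMIFIED normalisation — a base uniformiser `ϖ` has `v ϖ = exp(−2)`, `v 2 = exp(−2e)` (`e = ord_base 2`), and a base element of base-order `t` has `v = exp(−2t)`.
Two-field dress (§4): `j : E →+* K` with `v (j x) = (v x)²`, `ι ∘ j = j`, base data in `E` — the shape a wild ★ `exists_eigenField_package` will call with `j := toPlace v w`.

THE MATHEMATICS.  `α ∈ K` with `ια = −α`, `α² = 1 + w`, `ιw = w`, `v w = exp(−2t)`, `t = 2k + 1` odd (the odd-defect normal form ★ (C4)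
`exists_unit_mul_sq_depth_dichotomy` delivers for a unit of the wild class).  (V) `ι(α − 1) = −(α + 1)` and `(α − 1)(α + 1) = α² − 1 = w`, so `v(α − 1)² = v w`:
**`v(α − 1) = exp(−t)`** — no hypothesis `t < 2e` needed (it FOLLOWS: `(α + 1) − (α − 1) = 2` forces `v 2 ≤ exp(−t)`).  (Π1) **`Π := (α − 1)∕ϖ^k` is a uniformiser**:
`v Π = exp(−(2k+1) + 2k) = exp(−1)`.  (Π2) `ιΠ = (−α − 1)∕ϖ^k = −Π − 2∕ϖ^k`: **`Π + ιΠ = −2∕ϖ^k`**, **`Π·ιΠ = (1 − α²)∕ϖ^{2k} = −w∕ϖ^{2k}`**, so `Π` is a root of the EISENSTEIN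
polynomial **`X² + (2∕ϖ^k)X − w∕ϖ^{2k}`** (trace of base-order `e − k ≥ 1`, norm of base-order `1`) — the wild frame; the tame∕odd-order frame is the special shape `Π + ιΠ = 0`
(§3).  (Π3) **`v(ιΠ − Π) = v(2α∕ϖ^k) = exp(−2(e − k)) = exp(−(2e + 1 − t))`** — the DIFFERENT exponent `d(K₂∕K) = 2e + 1 − t`, matching ★ `RamifiedPlaceOrderDiscriminant` ∕
★ `WildQuadraticNormGroupAPI` (`f = d = 2e + 1 − s`, `s = t`).  (Π4, §3) ODD ORDER: `α² = D`, `v D = exp(−2(2m+1))` ⇒ `Π := α∕ϖ^m` is a uniformiser with `ιΠ = −Π`,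
`v(ιΠ − Π) = exp(−(2e+1))`.  (Π5, §2) COORDINATES for ANY `Π` with `ιΠ ≠ Π`: `z = a + bΠ` with `a, b` `ι`-fixed (`b = (z − ιz)∕(Π − ιΠ)`); if `ι`-fixed elements have even
`log v` (base parity) and `v Π = exp(−1)` then `v(a + bΠ) = max(v a, v b·exp(−1))` and `a + bΠ ∈ 𝒪 ⟺ a, b ∈ 𝒪` (`𝒪_{K₂} = 𝒪_K ⊕ 𝒪_K·Π`).  (Π6, §3b) in the
unit-discriminant frame every `ι`-ANTI-fixed `z ≠ 0` has EVEN `log v` (`zα` is `ι`-fixed, `v α = 1`) — the negation of the tame parity token ★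
`SymmetricEigenframeParity.odd_log_of_map_eq_neg` that drives ★ `TypeTwoSelfDualCyclicParity`; the token the M4 parity core swaps at the wild rows.

Layout: §0 field algebra (trace, norm, Eisenstein equation, `ιΠ − Π`, coordinates; no valuation) · §1 valuations (V), (Π1), (Π3), `k + 1 ≤ e` · §2 parity∕integrality of
coordinates · §3 odd-order twin (Π4) · §3b anti-fixed parity (Π6) · §4 two-field dress.  In Lean the uniformiser is spelled out as `(α - 1) / ϖ ^ k` (resp. a bound variable `P`;
`Π` is a reserved token).  ★ NEIGHBOURS (CM currency `L_w ∕ L⁺_v` at a RAMIFIED CM place, not this file's abstract `K₂∕K`): ★ `RamifiedPlaceEisensteinBasis` (coordinates and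
integral basis for ANY uniformiser), ★ `RamifiedPlaceDifferent.exists_skew_uniformizer_iff` ∕ `exists_skew_unit_iff` (skew uniformiser iff `exp(−d) = |2|·exp(−1)`), ★
`RamifiedPlaceAntiFixedUniformizer` (the tame anti-fixed uniformiser), ★ `RamifiedPlaceBlockWild` (the `∃ d α` package); generic tame frame ★ `RamifiedQuadraticOrderLattices` (`σϖ = −ϖ`).

## References
* [Serre1979] J.-P. Serre, *Local Fields*, GTM 67 (1979): Ch. I §6 Prop. 18 (Eisenstein equations; `𝒪_E = 𝒪_F[Π]`), Ch. III §6–§7 (different, discriminant), Ch. IV §1–§2 (`i_G`,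
  the quadratic case), Ch. XIV §4.
* [Omeara1963] O. T. O'Meara, *Introduction to Quadratic Forms*, Grundlehren 117 (1963): §63A 63:2–63:5 (quadratic defect `𝔭^t`, `t` odd `< 2e`, of a dyadic unit).
* [Jacobowitz1962] R. Jacobowitz, *Hermitian forms over local fields*, Amer. J. Math. 84 (1962): §§9–11 (ramified dyadic, «R-U» `E = F(√u)`: `π` with `π + π̄`, `ππ̄` prescribed).
-/

set_option autoImplicit false

noncomputable section

open scoped Valued
open WithZero

namespace Literature.NumberTheory.LocalFields

/-! ## §0 Field algebra of the skew element (no valuation): `ι(α − 1)`, trace, norm and Eisenstein equation of `Π = (α − 1)∕ϖ^k`; coordinates -/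

section Algebra

variable {K : Type*} [Field K] {ι : K →+* K}

/-- **(Π2) TRACE: `Π + ιΠ = −2∕ϖ^k`** for `Π = (α − 1)∕ϖ^k` (`ιΠ = (−α − 1)∕ϖ^k`). [cite: Serre1979, Ch. I §6 Prop. 18] [cite: Jacobowitz1962, §§9–11] -/
theorem wildUniformizer_add_map {α ϖ : K} (hια : ι α = -α) (hιϖ : ι ϖ = ϖ) (k : ℕ) :
    (α - 1) / ϖ ^ k + ι ((α - 1) / ϖ ^ k) = -(2 / ϖ ^ k) := by
  rw [map_div₀, map_pow, map_sub, map_one, hια, hιϖ]; ring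

/-- **(Π2) `ιΠ = −Π − 2∕ϖ^k`.** [cite: Serre1979, Ch. I §6 Prop. 18] [cite: Jacobowitz1962, §§9–11] -/
theorem map_wildUniformizer {α ϖ : K} (hια : ι α = -α) (hιϖ : ι ϖ = ϖ) (k : ℕ) :
    ι ((α - 1) / ϖ ^ k) = -((α - 1) / ϖ ^ k) - 2 / ϖ ^ k := by
  rw [map_div₀, map_pow, map_sub, map_one, hια, hιϖ]; ring

/-- **(Π2) NORM: `Π·ιΠ = −w∕ϖ^{2k}`** (`(α − 1)(−α − 1) = 1 − α² = −w`). [cite: Serre1979, Ch. I §6 Prop. 18] [cite: Jacobowitz1962, §§9–11] -/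
theorem wildUniformizer_mul_map {α w ϖ : K} (hια : ι α = -α) (hιϖ : ι ϖ = ϖ) (hα : α * α = 1 + w) (k : ℕ) :
    (α - 1) / ϖ ^ k * ι ((α - 1) / ϖ ^ k) = -(w / ϖ ^ (2 * k)) := by
  rw [map_div₀, map_pow, map_sub, map_one, hια, hιϖ, pow_mul', div_mul_div_comm, ← sq]
  rw [show (α - 1) * (-α - 1) = -(α * α - 1) by ring, hα, add_sub_cancel_left, neg_div]

/-- **(Π2) THE EISENSTEIN EQUATION `Π² + (2∕ϖ^k)·Π − w∕ϖ^{2k} = 0`** (`ϖ ≠ 0`): trace of base-order `e − k ≥ 1`, constant term of base-order exactly `1` — `Π` generates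
`𝒪_{K₂}` over the base. [cite: Serre1979, Ch. I §6 Prop. 18] [cite: Jacobowitz1962, §§9–11] -/
theorem wildUniformizer_eisenstein {α w ϖ : K} (hα : α * α = 1 + w) (hϖ0 : ϖ ≠ 0) (k : ℕ) :
    (α - 1) / ϖ ^ k * ((α - 1) / ϖ ^ k) + 2 / ϖ ^ k * ((α - 1) / ϖ ^ k) - w / ϖ ^ (2 * k) = 0 := by
  have hk : ϖ ^ k ≠ 0 := pow_ne_zero k hϖ0
  rw [show (α - 1) / ϖ ^ k * ((α - 1) / ϖ ^ k) + 2 / ϖ ^ k * ((α - 1) / ϖ ^ k) - w / ϖ ^ (2 * k) = (α * α - (1 + w)) / (ϖ ^ k * ϖ ^ k) by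
    rw [pow_mul', sq]; field_simp; ring, hα, sub_self, zero_div]

/-- **`ιΠ − Π = −2α∕ϖ^k`.** [cite: Serre1979, Ch. IV §1] -/
theorem map_wildUniformizer_sub {α ϖ : K} (hια : ι α = -α) (hιϖ : ι ϖ = ϖ) (k : ℕ) :
    ι ((α - 1) / ϖ ^ k) - (α - 1) / ϖ ^ k = -(2 * α / ϖ ^ k) := by
  rw [map_div₀, map_pow, map_sub, map_one, hια, hιϖ]; ring

/-- **(Π4) `ιΠ = −Π`** for the odd-order uniformiser `Π = α∕ϖ^m` (`ια = −α`, `ιϖ = ϖ`). [cite: Jacobowitz1962, §5] -/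
theorem map_oddUniformizer {α ϖ : K} (hια : ι α = -α) (hιϖ : ι ϖ = ϖ) (m : ℕ) : ι (α / ϖ ^ m) = -(α / ϖ ^ m) := by
  rw [map_div₀, map_pow, hια, hιϖ, neg_div]

/-- **(Π5) COORDINATES**: for an involution `ι` and any `Π` with `ιΠ ≠ Π`, every `z` is `a + b·Π` with `ι a = a`, `ι b = b` (`b = (z − ιz)∕(Π − ιΠ)`, `a = z − bΠ`).
[cite: Serre1979, Ch. I §6 Prop. 18] -/
theorem exists_fixed_coords_of_map_ne (hιι : ∀ x, ι (ι x) = x) {P : K} (hP : ι P ≠ P) (z : K) :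
    ∃ a b : K, ι a = a ∧ ι b = b ∧ z = a + b * P := by
  have hd : P - ι P ≠ 0 := sub_ne_zero.2 (Ne.symm hP)
  set b : K := (z - ι z) / (P - ι P) with hb
  have hιb : ι b = b := by
    rw [hb, map_div₀, map_sub, map_sub, hιι, hιι, ← neg_sub z, ← neg_sub P, neg_div_neg_eq]
  have key : z - ι z = b * (P - ι P) := by rw [hb, div_mul_cancel₀ _ hd]
  clear_value b
  refine ⟨z - b * P, b, ?_, hιb, by ring⟩
  rw [map_sub, map_mul, hιb]
  linear_combination (-1 : K) * key

end Algebra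

/-! ## §1 One field `K` with an isometric involution `ι`: `v(α − 1)`, the uniformiser `Π = (α − 1)∕ϖ^k`, the different `v(ιΠ − Π)` -/

section OneField

variable {K : Type*} [Field K] [Valued K ℤᵐ⁰] {ι : K →+* K}

/-- In `ℤᵐ⁰`: `x·x = exp(2n) ⇒ x = exp n`. [folklore] -/
private theorem eq_exp_of_mul_self_eq_exp {x : ℤᵐ⁰} {n : ℤ} (h : x * x = exp (2 * n)) : x = exp n := by
  have hx0 : x ≠ 0 := by
    intro h0; rw [h0, mul_zero] at h; exact exp_ne_zero h.symm
  rw [← exp_log hx0] at h ⊢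
  rw [← exp_add, exp_inj] at h
  rw [exp_inj]; omega

/-- **(V) `v(α − 1) = exp(−m)` for a SKEW `α` (`ια = −α`) with `α² = 1 + w`, `v w = exp(−2m)`**: `ι(α − 1) = −(α + 1)` (isometry: `v(α + 1) = v(α − 1)`) and
`(α + 1)(α − 1) = w`.  No hypothesis `m < ord 2`. [cite: Omeara1963, §63A 63:2–63:5] [cite: Jacobowitz1962, §9] -/
theorem v_skew_sub_one (hvι : ∀ x, Valued.v (ι x) = Valued.v x) {α w : K} (hια : ι α = -α) (hα : α * α = 1 + w) {m : ℤ}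
    (hw : Valued.v w = exp (-(2 * m))) : Valued.v (α - 1) = exp (-m) := by
  have h1 : Valued.v (α + 1) = Valued.v (α - 1) := by
    rw [← hvι (α - 1), map_sub, map_one, hια, show -α - 1 = -(α + 1) by ring, Valuation.map_neg]
  have h2 : Valued.v ((α + 1) * (α - 1)) = exp (2 * (-m)) := by
    rw [show (α + 1) * (α - 1) = α * α - 1 by ring, hα, add_sub_cancel_left, hw]; congr 1; ring
  rw [map_mul, h1] at h2
  exact eq_exp_of_mul_self_eq_exp h2

/-- **`v 2 ≤ v(α − 1)`**, i.e. `ord(α − 1) ≤ ord 2` — the bound `t ≤ 2e` on the defect order is AUTOMATIC: `2 = (α + 1) − (α − 1)` and both have the same value.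
[cite: Omeara1963, §63A 63:2] -/
theorem v_two_le_v_skew_sub_one (hvι : ∀ x, Valued.v (ι x) = Valued.v x) {α : K} (hια : ι α = -α) : Valued.v (2 : K) ≤ Valued.v (α - 1) := by
  have h1 : Valued.v (α + 1) = Valued.v (α - 1) := by
    rw [← hvι (α - 1), map_sub, map_one, hια, show -α - 1 = -(α + 1) by ring, Valuation.map_neg]
  rw [show (2 : K) = (α + 1) - (α - 1) by ring]
  exact (Valuation.map_sub _ _ _).trans (by rw [h1, max_self])

/-- A skew `α` with `α² = 1 + w`, `v w < 1`, is a unit: `v α = 1`. [cite: Omeara1963, §63A 63:2] -/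
theorem v_skew_eq_one {α w : K} (hα : α * α = 1 + w) (hw : Valued.v w < 1) : Valued.v α = 1 := by
  have h : Valued.v α * Valued.v α = exp (2 * 0) := by
    rw [← map_mul, hα, Valuation.map_one_add_of_lt _ hw, mul_zero, exp_zero]
  exact (eq_exp_of_mul_self_eq_exp h).trans exp_zero

/-- **(Π1) THE WILD UNIFORMISER**: `Π := (α − 1)∕ϖ^k` has `v Π = exp(−1)` when `v w = exp(−2(2k+1))` (base-order `t = 2k + 1` of `w`, ramified normalisation) and `v ϖ = exp(−2)`
(`ϖ` a base uniformiser). [cite: Serre1979, Ch. I §6 Prop. 18] [cite: Omeara1963, §63A 63:3] [cite: Jacobowitz1962, §§9–11] -/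
theorem v_wildUniformizer (hvι : ∀ x, Valued.v (ι x) = Valued.v x) {α w ϖ : K} (hια : ι α = -α) (hα : α * α = 1 + w) {k : ℕ}
    (hw : Valued.v w = exp (-(2 * (2 * (k : ℤ) + 1)))) (hϖ : Valued.v ϖ = exp (-2 : ℤ)) :
    Valued.v ((α - 1) / ϖ ^ k) = exp (-1 : ℤ) := by
  rw [map_div₀, map_pow, v_skew_sub_one hvι hια hα hw, hϖ, ← exp_nsmul, ← exp_sub, exp_inj, nsmul_eq_mul]
  ring

/-- **(Π3) THE DIFFERENT: `v(ιΠ − Π) = exp(−2(e − k)) = exp(−(2e + 1 − t))`** for `v 2 = exp(−2e)`, `v ϖ = exp(−2)`, `v w = exp(−2(2k+1)) < 1` (`α` is then a unit):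
the different exponent `d(K₂∕K) = 2e + 1 − t` of the wild quadratic `K₂ = K(√(1+w))`, `ord w = t = 2k+1` — even, `≥ 2`; the conductor `f = 2e + 1 − s` of ★
`WildQuadraticNormGroupAPI.conductor_one_add_of_odd_defect`. [cite: Serre1979, Ch. III §6–§7; Ch. IV §1–§2] [cite: Omeara1963, §63A 63:3] -/
theorem v_map_wildUniformizer_sub {α w ϖ : K} (hια : ι α = -α) (hιϖ : ι ϖ = ϖ) (hα : α * α = 1 + w)
    {k e : ℕ} (hw : Valued.v w = exp (-(2 * (2 * (k : ℤ) + 1)))) (hϖ : Valued.v ϖ = exp (-2 : ℤ)) (he : Valued.v (2 : K) = exp (-(2 * (e : ℤ)))) :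
    Valued.v (ι ((α - 1) / ϖ ^ k) - (α - 1) / ϖ ^ k) = exp (-(2 * ((e : ℤ) - k))) := by
  have hw1 : Valued.v w < 1 := by rw [hw, ← exp_zero, exp_lt_exp]; omega
  rw [map_wildUniformizer_sub hια hιϖ, Valuation.map_neg, map_div₀, map_mul, map_pow, he, v_skew_eq_one hα hw1, mul_one, hϖ, ← exp_nsmul,
    ← exp_sub, exp_inj, nsmul_eq_mul]
  ring

/-- **`k + 1 ≤ e`** — the defect order `t = 2k + 1` is `< 2e` AUTOMATICALLY (`v 2 ≤ v(α − 1)`, ★ `v_two_le_v_skew_sub_one`). [cite: Omeara1963, §63A 63:2] -/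
theorem succ_le_of_skew (hvι : ∀ x, Valued.v (ι x) = Valued.v x) {α w : K} (hια : ι α = -α) (hα : α * α = 1 + w) {k e : ℕ}
    (hw : Valued.v w = exp (-(2 * (2 * (k : ℤ) + 1)))) (he : Valued.v (2 : K) = exp (-(2 * (e : ℤ)))) : k + 1 ≤ e := by
  have h := v_two_le_v_skew_sub_one hvι hια
  rw [he, v_skew_sub_one hvι hια hα hw, exp_le_exp] at h
  omega

end OneField

/-! ## §2 Parity and integrality of the coordinates `z = a + b·Π` -/

section Coordinates

variable {K : Type*} [Field K] [Valued K ℤᵐ⁰] {ι : K →+* K}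

/-- **PARITY ⇒ `v(a + b·Π) = max (v a) (v b · exp(−1))`** when `ι`-fixed elements have EVEN `log v` (base parity in the ramified normalisation) and `v Π = exp(−1)`: the two
values have opposite parity, so no cancellation. [cite: Serre1979, Ch. I §6 Prop. 18; Ch. II §2] -/
theorem v_fixed_add_fixed_mul_eq_max (hfix : ∀ c : K, ι c = c → c ≠ 0 → Even (log (Valued.v c)))
    {P : K} (hvP : Valued.v P = exp (-1 : ℤ)) {a b : K} (ha : ι a = a) (hb : ι b = b) :
    Valued.v (a + b * P) = max (Valued.v a) (Valued.v b * exp (-1 : ℤ)) := by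
  rcases eq_or_ne b 0 with rfl | hb0
  · simp
  rcases eq_or_ne a 0 with rfl | ha0
  · rw [zero_add, map_mul, hvP, map_zero]
    exact (max_eq_right zero_le).symm
  have hne : Valued.v a ≠ Valued.v (b * P) := by
    intro h
    obtain ⟨m, hm⟩ := hfix a ha ha0
    obtain ⟨n, hn⟩ := hfix b hb hb0
    have hvb0 : Valued.v b ≠ 0 := (Valuation.ne_zero_iff _).2 hb0
    have h' := congrArg log h
    rw [map_mul, hvP, log_mul hvb0 exp_ne_zero, log_exp, hm, hn] at h'
    omega
  rw [Valuation.map_add_of_distinct_val _ hne, map_mul, hvP]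

/-- **INTEGRALITY `a + b·Π ∈ 𝒪 ⟺ a, b ∈ 𝒪`** (`𝒪_{K₂} = 𝒪_K ⊕ 𝒪_K·Π` for the Eisenstein uniformiser) under base parity and `v Π = exp(−1)`: `v b·exp(−1) ≤ 1` forces
`log v b ≤ 1`, and `log v b` is even. [cite: Serre1979, Ch. I §6 Prop. 18] -/
theorem v_fixed_add_fixed_mul_le_one_iff (hfix : ∀ c : K, ι c = c → c ≠ 0 → Even (log (Valued.v c)))
    {P : K} (hvP : Valued.v P = exp (-1 : ℤ)) {a b : K} (ha : ι a = a) (hb : ι b = b) :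
    Valued.v (a + b * P) ≤ 1 ↔ Valued.v a ≤ 1 ∧ Valued.v b ≤ 1 := by
  rw [v_fixed_add_fixed_mul_eq_max hfix hvP ha hb, max_le_iff]
  refine ⟨fun ⟨h1, h2⟩ => ⟨h1, ?_⟩, fun ⟨h1, h2⟩ => ⟨h1, ?_⟩⟩
  · rcases eq_or_ne b 0 with rfl | hb0
    · rw [map_zero]; exact zero_le
    obtain ⟨n, hn⟩ := hfix b hb hb0
    have hvb0 : Valued.v b ≠ 0 := (Valuation.ne_zero_iff _).2 hb0
    rw [← exp_log hvb0, ← exp_zero, exp_le_exp]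
    rw [← exp_log hvb0, ← exp_add, ← exp_zero, exp_le_exp] at h2
    omega
  · calc Valued.v b * exp (-1 : ℤ) ≤ 1 * exp (-1 : ℤ) := mul_le_mul_left h2 _
      _ ≤ 1 := by rw [one_mul, ← exp_zero, exp_le_exp]; norm_num

end Coordinates

/-! ## §3 The ODD-ORDER (tame-shape) twin: `α² = D`, `ord D = 2m + 1`, `Π := α∕ϖ^m`, `ιΠ = −Π` -/

section OddOrder

variable {K : Type*} [Field K] [Valued K ℤᵐ⁰] {ι : K →+* K}

/-- **(Π4) `Π := α∕ϖ^m` is a uniformiser** when `α² = D`, `v D = exp(−2(2m+1))`, `v ϖ = exp(−2)`. [cite: Serre1979, Ch. I §6 Prop. 18] [cite: Jacobowitz1962, §5] -/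
theorem v_oddUniformizer {α D ϖ : K} (hα : α * α = D) {m : ℕ} (hD : Valued.v D = exp (-(2 * (2 * (m : ℤ) + 1)))) (hϖ : Valued.v ϖ = exp (-2 : ℤ)) :
    Valued.v (α / ϖ ^ m) = exp (-1 : ℤ) := by
  have hvα : Valued.v α = exp (-(2 * (m : ℤ) + 1)) := by
    refine eq_exp_of_mul_self_eq_exp ?_
    rw [← map_mul, hα, hD]; congr 1
  rw [map_div₀, map_pow, hvα, hϖ, ← exp_nsmul, ← exp_sub, exp_inj, nsmul_eq_mul]
  ring

/-- **(Π4) `v(ιΠ − Π) = exp(−(2e + 1))`** — the different exponent `2e + 1` of the odd-order (at `e = 0`: tame) quadratic. [cite: Serre1979, Ch. III §6; Ch. IV §1] -/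
theorem v_map_oddUniformizer_sub {α D ϖ : K} (hια : ι α = -α) (hιϖ : ι ϖ = ϖ) (hα : α * α = D) {m e : ℕ}
    (hD : Valued.v D = exp (-(2 * (2 * (m : ℤ) + 1)))) (hϖ : Valued.v ϖ = exp (-2 : ℤ)) (he : Valued.v (2 : K) = exp (-(2 * (e : ℤ)))) :
    Valued.v (ι (α / ϖ ^ m) - α / ϖ ^ m) = exp (-(2 * (e : ℤ) + 1)) := by
  rw [map_oddUniformizer hια hιϖ, show -(α / ϖ ^ m) - α / ϖ ^ m = -(2 * (α / ϖ ^ m)) by ring, Valuation.map_neg, map_mul, he,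
    v_oddUniformizer hα hD hϖ, ← exp_add, exp_inj]
  ring

end OddOrder

/-! ## §3b (Π6) In the wild (unit-discriminant) frame `ι`-ANTI-FIXED elements have EVEN order — the negation of the tame token ★ `SymmetricEigenframeParity.odd_log_of_map_eq_neg` -/

section AntiFixedEven

variable {K : Type*} [Field K] [Valued K ℤᵐ⁰]

/-- **(Π6) `ι`-ANTI-FIXED ELEMENTS HAVE EVEN `log v`** when the `ι`-fixed non-zero elements do (base parity) and SOME anti-fixed `α` of even `log v` exists (`z·α` is
`ι`-fixed) — the twin of ★ `SymmetricEigenframeParity.odd_log_of_map_eq_neg` (there `θ` anti-fixed of ODD order forces odd; here the wild skew UNIT `α` forces even): the token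
the M4 parity core swaps at the wild rows. [cite: Serre1979, Ch. I §6] [cite: Jacobowitz1962, §§9–11] -/
theorem even_log_of_map_eq_neg (ι : K →+* K) (hfix : ∀ c : K, ι c = c → c ≠ 0 → Even (log (Valued.v c)))
    {α : K} (hα0 : α ≠ 0) (hια : ι α = -α) (hαev : Even (log (Valued.v α)))
    {z : K} (hz0 : z ≠ 0) (hz : ι z = -z) : Even (log (Valued.v z)) := by
  have hfz : ι (z * α) = z * α := by rw [map_mul, hz, hια, neg_mul_neg]
  have hev := hfix (z * α) hfz (mul_ne_zero hz0 hα0)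
  rw [map_mul, log_mul ((Valuation.ne_zero_iff _).2 hz0) ((Valuation.ne_zero_iff _).2 hα0)] at hev
  obtain ⟨n, hn⟩ := hev
  obtain ⟨m, hm⟩ := hαev
  exact ⟨n - m, by omega⟩

/-- **(Π6) in the unit-discriminant frame `α² = 1 + w`, `v w < 1`**: every `ι`-anti-fixed `z ≠ 0` has EVEN `log v` (`v α = 1`, ★ `v_skew_eq_one`); equivalently
`v z ∈ exp(2ℤ)` — no anti-fixed uniformiser exists in the wild frame. [cite: Serre1979, Ch. I §6] [cite: Omeara1963, §63A 63:3] [cite: Jacobowitz1962, §§9–11] -/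
theorem even_log_of_map_eq_neg_of_skew_sq (ι : K →+* K) (hfix : ∀ c : K, ι c = c → c ≠ 0 → Even (log (Valued.v c)))
    {α w : K} (hια : ι α = -α) (hα : α * α = 1 + w) (hw : Valued.v w < 1)
    {z : K} (hz0 : z ≠ 0) (hz : ι z = -z) : Even (log (Valued.v z)) := by
  have hvα : Valued.v α = 1 := v_skew_eq_one hα hw
  have hα0 : α ≠ 0 := fun h => by rw [h, map_zero] at hvα; exact zero_ne_one hvα
  exact even_log_of_map_eq_neg ι hfix hα0 hια (by rw [hvα, log_one]; exact ⟨0, rfl⟩) hz0 hz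

/-- … in the shape «`v z = exp(2m)`» of LH4-plan (g6) WORD #17b. [cite: Serre1979, Ch. I §6] [cite: Jacobowitz1962, §§9–11] -/
theorem exists_v_eq_exp_two_mul_of_map_eq_neg (ι : K →+* K) (hfix : ∀ c : K, ι c = c → c ≠ 0 → Even (log (Valued.v c)))
    {α w : K} (hια : ι α = -α) (hα : α * α = 1 + w) (hw : Valued.v w < 1)
    {z : K} (hz0 : z ≠ 0) (hz : ι z = -z) : ∃ m : ℤ, Valued.v z = exp (2 * m) := by
  obtain ⟨m, hm⟩ := even_log_of_map_eq_neg_of_skew_sq ι hfix hια hα hw hz0 hz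
  refine ⟨m, ?_⟩
  rw [← exp_log ((Valuation.ne_zero_iff _).2 hz0 : Valued.v z ≠ 0), hm, two_mul]

end AntiFixedEven

/-! ## §4 Two-field dress: `j : E →+* K` with `v(j x) = (v x)²`, `ι ∘ j = j`, base data in `E` -/

section TwoField

variable {E K : Type*} [Field E] [Field K] [Valued E ℤᵐ⁰] [Valued K ℤᵐ⁰] (j : E →+* K) {ι : K →+* K}

/-- **BASE PARITY** from the two-field token `v(j x) = (v x)²`: `log v (j x)` is even. [cite: Serre1979, Ch. II §2] -/
theorem even_log_v_map (hjv : ∀ x, Valued.v (j x) = Valued.v x ^ 2) {x : E} (hx : x ≠ 0) : Even (log (Valued.v (j x))) := by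
  have hvx : Valued.v x ≠ 0 := (Valuation.ne_zero_iff _).2 hx
  refine ⟨log (Valued.v x), ?_⟩
  rw [hjv, ← exp_log hvx, ← exp_nsmul, log_exp, log_exp, two_nsmul]

/-- The parity token `hfix` of §2 from «`Fix ι = j E`» and `v(j x) = (v x)²`. [cite: Serre1979, Ch. II §2] -/
theorem even_log_v_of_fixed (hjv : ∀ x, Valued.v (j x) = Valued.v x ^ 2) (hsurj : ∀ c : K, ι c = c → ∃ x : E, c = j x)
    (c : K) (hc : ι c = c) (hc0 : c ≠ 0) : Even (log (Valued.v c)) := by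
  obtain ⟨x, rfl⟩ := hsurj c hc
  exact even_log_v_map j hjv fun h => hc0 (by rw [h, map_zero])

omit [Valued E ℤᵐ⁰] [Valued K ℤᵐ⁰] in
/-- **(Π2) two-field: `Π + ιΠ = −j(2∕ϖ^k)`, `Π·ιΠ = −j(w∕ϖ^{2k})`** — the trace and norm of `Π = (α − 1)∕(jϖ)^k` lie in `j E`. [cite: Serre1979, Ch. I §6 Prop. 18] [cite: Jacobowitz1962, §§9–11] -/
theorem wildUniformizer_trace_norm_map (hιj : ∀ x, ι (j x) = j x) {α : K} {w ϖ : E} (hια : ι α = -α) (hα : α * α = 1 + j w) (k : ℕ) :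
    (α - 1) / j ϖ ^ k + ι ((α - 1) / j ϖ ^ k) = -j (2 / ϖ ^ k) ∧ (α - 1) / j ϖ ^ k * ι ((α - 1) / j ϖ ^ k) = -j (w / ϖ ^ (2 * k)) := by
  refine ⟨?_, ?_⟩
  · rw [wildUniformizer_add_map hια (hιj ϖ) k, map_div₀, map_ofNat, map_pow]
  · rw [wildUniformizer_mul_map hια (hιj ϖ) hα k, map_div₀, map_pow]

/-- **(Π1) two-field: `v((α − 1)∕(jϖ)^k) = exp(−1)`** for `α² = 1 + j w`, `ια = −α`, `v w = exp(−(2k+1))`, `v ϖ = exp(−1)` in `E`.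
[cite: Serre1979, Ch. I §6 Prop. 18] [cite: Omeara1963, §63A 63:3] -/
theorem v_wildUniformizer_map (hjv : ∀ x, Valued.v (j x) = Valued.v x ^ 2) (hvι : ∀ x, Valued.v (ι x) = Valued.v x) {α : K} {w ϖ : E}
    (hια : ι α = -α) (hα : α * α = 1 + j w) {k : ℕ} (hw : Valued.v w = exp (-(2 * (k : ℤ) + 1))) (hϖ : Valued.v ϖ = exp (-1 : ℤ)) :
    Valued.v ((α - 1) / j ϖ ^ k) = exp (-1 : ℤ) := by
  refine v_wildUniformizer hvι hια hα ?_ ?_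
  · rw [hjv, hw, ← exp_nsmul, nsmul_eq_mul]; congr 1
  · rw [hjv, hϖ, ← exp_nsmul, nsmul_eq_mul]; norm_num

/-- **(Π3) two-field: `v(ιΠ − Π) = exp(−2(e − k))`** for `v 2 = exp(−e)` in `E`. [cite: Serre1979, Ch. III §6–§7; Ch. IV §1–§2] -/
theorem v_map_wildUniformizer_sub_map (hjv : ∀ x, Valued.v (j x) = Valued.v x ^ 2) (hιj : ∀ x, ι (j x) = j x) {α : K} {w ϖ : E}
    (hια : ι α = -α) (hα : α * α = 1 + j w) {k e : ℕ}
    (hw : Valued.v w = exp (-(2 * (k : ℤ) + 1))) (hϖ : Valued.v ϖ = exp (-1 : ℤ)) (he : Valued.v (2 : E) = exp (-(e : ℤ))) :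
    Valued.v (ι ((α - 1) / j ϖ ^ k) - (α - 1) / j ϖ ^ k) = exp (-(2 * ((e : ℤ) - k))) := by
  refine v_map_wildUniformizer_sub hια (hιj ϖ) hα ?_ ?_ ?_
  · rw [hjv, hw, ← exp_nsmul, nsmul_eq_mul]; congr 1
  · rw [hjv, hϖ, ← exp_nsmul, nsmul_eq_mul]; norm_num
  · rw [← map_ofNat j 2, hjv, he, ← exp_nsmul, nsmul_eq_mul]; congr 1; push_cast; ring

end TwoField

end Literature.NumberTheory.LocalFields

end
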